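import Literature.NumberTheory.GelbartRogawski1991.LocalSplittingUnitary
import Literature.NumberTheory.GelbartRogawski1991.LocalSplittingL2Metaplectic
import Literature.NumberTheory.GelbartRogawski1991.LocalLeraySection
import Mathlib.Analysis.InnerProductSpace.Basic
import HarnessLib

/-!
# Finite-dimensionality of the fixed vectors of a subgroup of `S̃p_{ψ_v}(𝕎_v)` on `𝒮(F_vᴺ)` from an EXPANSION property
# (the lattice-model support bound, written model-free on the tree's local Schrödinger model)

Topic `NumberTheory/GelbartRogawski1991`; namespace `Literature.NumberTheory.GelbartRogawski1991.UnitaryDualPair.LocalSplitting`.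
KERNEL ONLY: theorems; no definition, no named fact, no record, no `sorry`.

Setting of `LocalUnitarySplittingDatum.lean`: `F` a number field, `v` a finite place, `T ∈ GL_N(F)` symmetric-or-not with
`det T` a unit, `𝕎_v = F_vᴺ × F_vᴺ` with `B = polar β_{𝕋_v}` (`B (x, y) (x', y') = ⟨x, 𝕋_v y'⟩`), the Heisenberg group
`H = Heisenberg B` (law `(w, t)(w', t') = (w + w', t + t' + B w w')`), the smooth Schrödinger model
`ρ = localSchrodinger F N T v` on `𝒮(F_vᴺ)` with central character `ψ_v = adeleAddCharAt F v`, and its group of pairs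
`LocalMp F N T v = MpPsi ρ` (`(g, M)` with `M ρ(h) = ρ(g · h) M`, `g · (w, t) = (g w, t + ½ (B (gw) (gw) - B w w))`).

For a group `G` mapped to `LocalMp` by `σ` (e.g. a unitary group through a splitting) and a subgroup `K ≤ G`, this file proves
the abstract engine behind the classical LATTICE-MODEL SUPPORT BOUND for theta lifts from compact groups
([MoeglinVignerasWaldspurger1987, Chap. 2 II.8; Chap. 3 IV], [Howe1979, §2]): the space of `K`-fixed vectors
`{f ∈ 𝒮(F_vᴺ) | σ(k) f = f ∀ k ∈ K}` is FINITE-DIMENSIONAL as soon as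

* (a) `K` fixes one non-zero `φ₀ ∈ 𝒮(F_vᴺ)`;
* (b) EXPANSION: there are an open `Λ ∋ 0` in `𝕎_v` whose Heisenberg translations `ρ(a, 0)`, `a ∈ Λ`, fix `φ₀`, and a compact
  `Ω ⊆ 𝕎_v`, such that every `w ∉ Ω` is moved by some `k ∈ K` (acting through `g = p(σ k) ∈ Sp(𝕎_v)`) by a vector
  `g w - w ∈ Λ` with NON-TRIVIAL PHASE `ψ_v(½ (B (gw) (gw) - B w w) - B w (g w - w)) ≠ 1`.

Mechanism (§2–§4): the coefficients `c_f(h) = ⟪[ρ(h) φ₀], [f]⟫_{L²(F_vᴺ)}` (`SchwartzBruhat.toLp`, Mathlib's inner product on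
`Lp ℂ 2`) satisfy `c_f(g · h) = c_f(h)` for `k ∈ K` (§2: the operator of `σ k` is a unit multiple of an `L²`-isometric
implementer — `exists_isometric_implementer_localSchrodinger`, `implementerUniqueUpToScalar_localSchrodinger` — and the
unit has modulus `1` because `φ₀ ≠ 0` is fixed; polarization), `c_f(z h) = ψ_v(z)⁻¹ c_f(h)` for central `z` and
`c_f(h (a, 0)) = c_f(h)` for `a ∈ Λ`; comparing the two routes from `(w, 0)` to `g · (w, 0) = z · (w, 0) (a, 0)` gives
`c_f(w, 0) = 0` off `Ω` (§3); on `Ω`, finitely many `Λ`-translates determine `c_f` (§4); and `c_f ≡ 0 ⇒ f = 0` by the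
IRREDUCIBILITY of the unitary Schrödinger representation on `L²(F_vᴺ)` (`localSchrodingerL2_irreducible`: the closed span
of the orbit of `[φ₀]` is everything).  Main result: **`finite_fixedPoints_of_expansion`** (§4).

Consumer: the admissibility of the local theta lift of a character of the compact `U(1)` to `U(N)` at a non-split place
(`RepresentationTheory/MoeglinVignerasWaldspurger1987/RankOneThetaLiftAdmissibleProofs.lean`), where (b) is supplied by
unitary reflections close to `1`.  Nothing of the cited sources is asserted; everything is proved from Mathlib and the tree.

## References
* [MoeglinVignerasWaldspurger1987] C. Mœglin, M.-F. Vignéras, J.-L. Waldspurger, *Correspondances de Howe sur un corps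
  p-adique*, LNM 1291 (1987), Chap. 2 II.1 (pairs `(g, M)`), II.8 (lattice models), Chap. 3 IV.
* [Howe1979] R. Howe, *θ-series and invariant theory*, Proc. Symp. Pure Math. 33.1 (1979) 275–285, §2.
* [Weil1964] A. Weil, Acta Math. 111 (1964), Chap. I n° 11–13.
-/

set_option autoImplicit false

noncomputable section

open NumberField IsDedekindDomain MeasureTheory
open Literature.RepresentationTheory.HeisenbergGroup
open Literature.NumberTheory.Automorphic
open scoped ENNReal InnerProductSpace

namespace Literature.NumberTheory.GelbartRogawski1991.UnitaryDualPair.LocalSplitting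

variable {F : Type} [Field F] [NumberField F] {N : ℕ} {T : Matrix (Fin N) (Fin N) F}
  {v : HeightOneSpectrum (𝓞 F)}

/-! ## §1 The central character and the Heisenberg law, read on the local Schrödinger model -/

/-- `ρ((0, t) h) Φ = ψ_v(t) • ρ(h) Φ`: the centre of `H(𝕎_v)` acts through `ψ_v`.
[cite: MoeglinVignerasWaldspurger1987, Chap. 2 I.2] -/
theorem localSchrodinger_center_mul (t : v.adicCompletion F) (h : Heisenberg (polar (localPairing F N T v)))
    (Φ : SchwartzBruhat (Fin N → v.adicCompletion F)) :
    localSchrodinger F N T v (⟨0, t⟩ * h) Φ = ((adeleAddCharAt F v t : Circle) : ℂ) • localSchrodinger F N T v h Φ := by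
  have hc : (⟨0, t⟩ : Heisenberg (polar (localPairing F N T v))) =
      Heisenberg.ofCenter (polar (localPairing F N T v)) (Multiplicative.ofAdd t) :=
    Heisenberg.ext (by simp) (by simp)
  rw [map_mul, Module.End.mul_apply, hc, localSchrodinger, schrodingerSB_ofCenter]

/-- `(w, 0) (a, 0) = (0, -B w a)⁻¹ …`: precisely `(w + a, 0) = (0, -B w a) · ((w, 0) (a, 0))` in `H(𝕎_v)`. [folklore] -/
private theorem heisenberg_mk_add_zero (w a : (Fin N → v.adicCompletion F) × (Fin N → v.adicCompletion F)) :
    (⟨w + a, 0⟩ : Heisenberg (polar (localPairing F N T v))) =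
      ⟨0, -(polar (localPairing F N T v) w a)⟩ * (⟨w, 0⟩ * ⟨a, 0⟩) :=
  Heisenberg.ext (by simp) (by simp)

/-- the pseudo-symplectic action of `g ∈ Sp(𝕎_v)` on `(w, 0)` factors through the Heisenberg law:
`g · (w, 0) = (0, f_g(w) - B w (gw - w)) · ((w, 0) (gw - w, 0))`. [cite: Weil1964, n° 5, pp. 150–151] -/
theorem ofSymplectic_act_mk_zero (g : LocalSp F N T v) (w : (Fin N → v.adicCompletion F) × (Fin N → v.adicCompletion F)) :
    (ofSymplectic (polar (localPairing F N T v)) g).act ⟨w, 0⟩ =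
      ⟨0, (ofSymplectic (polar (localPairing F N T v)) g).f w - polar (localPairing F N T v) w (g.1 w - w)⟩ *
        (⟨w, 0⟩ * ⟨g.1 w - w, 0⟩) :=
  Heisenberg.ext (by simp) (by simp)

/-! ## §2 The coefficients `⟪[ρ(h) φ₀], [f]⟫` are invariant under a pair `(g, M)` fixing `φ₀` and `f` -/

section MeasureA

variable [MeasurableSpace (v.adicCompletion F)] [BorelSpace (v.adicCompletion F)]
  (μ' : Measure (v.adicCompletion F)) [μ'.IsAddHaarMeasure]

/-- polarization: a linear endomorphism of `𝒮(F_vᴺ)` preserving the `L²` norm preserves the `L²` inner products of the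
classes `[Φ] ∈ L²(F_vᴺ)`. [folklore] -/
private theorem inner_toLp_map_map_of_norm_eq
    (M : SchwartzBruhat (Fin N → v.adicCompletion F) →ₗ[ℂ] SchwartzBruhat (Fin N → v.adicCompletion F))
    (hM : haveI := secondCountableTopology_adicCompletion F v
      ∀ Φ, ‖SchwartzBruhat.toLp (Measure.pi fun _ : Fin N => μ') (M Φ)‖ =
        ‖SchwartzBruhat.toLp (Measure.pi fun _ : Fin N => μ') Φ‖)
    (a b : SchwartzBruhat (Fin N → v.adicCompletion F)) :
    haveI := secondCountableTopology_adicCompletion F v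
    ⟪SchwartzBruhat.toLp (Measure.pi fun _ : Fin N => μ') (M a), SchwartzBruhat.toLp (Measure.pi fun _ : Fin N => μ') (M b)⟫_ℂ =
      ⟪SchwartzBruhat.toLp (Measure.pi fun _ : Fin N => μ') a, SchwartzBruhat.toLp (Measure.pi fun _ : Fin N => μ') b⟫_ℂ := by
  haveI := secondCountableTopology_adicCompletion F v
  set L := SchwartzBruhat.toLp (Measure.pi fun _ : Fin N => μ') with hL
  rw [inner_eq_sum_norm_sq_div_four, inner_eq_sum_norm_sq_div_four]
  have h1 : ‖L (M a) + L (M b)‖ = ‖L a + L b‖ := by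
    rw [← map_add, ← map_add, hM, map_add]
  have h2 : ‖L (M a) - L (M b)‖ = ‖L a - L b‖ := by
    rw [← map_sub, ← map_sub, hM, map_sub]
  have h3 : ‖L (M a) - (RCLike.I : ℂ) • L (M b)‖ = ‖L a - (RCLike.I : ℂ) • L b‖ := by
    rw [← map_smul, ← map_sub, ← map_smul, ← map_sub, hM, map_sub, map_smul]
  have h4 : ‖L (M a) + (RCLike.I : ℂ) • L (M b)‖ = ‖L a + (RCLike.I : ℂ) • L b‖ := by
    rw [← map_smul, ← map_add, ← map_smul, ← map_add, hM, map_add, map_smul]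
  rw [h1, h2, h3, h4]

/-- **a pair `(g, M) ∈ S̃p_{ψ_v}(𝕎_v)` whose operator fixes a non-zero vector preserves all `L²` inner products on
`𝒮(F_vᴺ)`**: `M = c · U` with `U` an `L²`-isometric implementer of `g` (implementers are unique up to scalars), and
`|c| = 1` because `‖φ₀‖ = ‖M φ₀‖ = |c| ‖φ₀‖ ≠ 0`. [cite: MoeglinVignerasWaldspurger1987, Chap. 2 II.1–II.2] -/
theorem inner_toLp_toRep_toRep (hTd : IsUnit T.det) (p : LocalMp F N T v)
    {φ₀ : SchwartzBruhat (Fin N → v.adicCompletion F)} (hφ₀ : φ₀ ≠ 0) (hp : MpPsi.toRep _ p φ₀ = φ₀)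
    (a b : SchwartzBruhat (Fin N → v.adicCompletion F)) :
    haveI := secondCountableTopology_adicCompletion F v
    ⟪SchwartzBruhat.toLp (Measure.pi fun _ : Fin N => μ') (MpPsi.toRep _ p a),
        SchwartzBruhat.toLp (Measure.pi fun _ : Fin N => μ') (MpPsi.toRep _ p b)⟫_ℂ =
      ⟪SchwartzBruhat.toLp (Measure.pi fun _ : Fin N => μ') a, SchwartzBruhat.toLp (Measure.pi fun _ : Fin N => μ') b⟫_ℂ := by
  haveI := secondCountableTopology_adicCompletion F v
  obtain ⟨U, hU, hUi⟩ := exists_isometric_implementer_localSchrodinger (hTd := hTd) μ' (MpPsi.proj _ p)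
  obtain ⟨c, hc⟩ := implementerUniqueUpToScalar_localSchrodinger F N T hTd v (MpPsi.proj _ p) U (MpPsi.toOp _ p) hU
    (MpPsi.toRep_implements _ p)
  have hop : ∀ f, MpPsi.toRep _ p f = ((c : ℂˣ) : ℂ) • U f := fun f => hc f
  -- `|c|² = 1`
  have h0 : SchwartzBruhat.l2NormSq (Measure.pi fun _ : Fin N => μ') φ₀ ≠ 0 :=
    (SchwartzBruhat.l2NormSq_pos _ hφ₀).ne'
  have htop : SchwartzBruhat.l2NormSq (Measure.pi fun _ : Fin N => μ') φ₀ ≠ ∞ := SchwartzBruhat.l2NormSq_ne_top _ φ₀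
  have hc1 : ‖((c : ℂˣ) : ℂ)‖ₑ ^ 2 = 1 := by
    have h1 : ‖((c : ℂˣ) : ℂ)‖ₑ ^ 2 * SchwartzBruhat.l2NormSq (Measure.pi fun _ : Fin N => μ') φ₀ =
        1 * SchwartzBruhat.l2NormSq (Measure.pi fun _ : Fin N => μ') φ₀ := by
      rw [one_mul]
      conv_rhs => rw [← hp, hop, SchwartzBruhat.l2NormSq_smul, hUi]
    exact (ENNReal.mul_left_inj h0 htop).1 h1
  have hnorm : ∀ Φ, SchwartzBruhat.l2NormSq (Measure.pi fun _ : Fin N => μ') (MpPsi.toRep _ p Φ) =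
      SchwartzBruhat.l2NormSq (Measure.pi fun _ : Fin N => μ') Φ := fun Φ => by
    rw [hop, SchwartzBruhat.l2NormSq_smul, hc1, one_mul, hUi]
  exact inner_toLp_map_map_of_norm_eq μ' (MpPsi.toRep _ p)
    (fun Φ => SchwartzBruhat.norm_toLp_eq_of_l2NormSq_eq _ (hnorm Φ)) a b

/-- **invariance of the coefficients**: if the operator of `p = (g, M)` fixes `φ₀ ≠ 0` and `f`, then
`⟪[ρ(g · h) φ₀], [f]⟫ = ⟪[ρ(h) φ₀], [f]⟫` for every `h ∈ H(𝕎_v)` (`ρ(g · h) = M ρ(h) M⁻¹` and §2).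
[cite: MoeglinVignerasWaldspurger1987, Chap. 2 II.1 (A)] -/
theorem inner_toLp_act (hTd : IsUnit T.det) (p : LocalMp F N T v)
    {φ₀ : SchwartzBruhat (Fin N → v.adicCompletion F)} (hφ₀ : φ₀ ≠ 0) (hp : MpPsi.toRep _ p φ₀ = φ₀)
    {f : SchwartzBruhat (Fin N → v.adicCompletion F)} (hf : MpPsi.toRep _ p f = f)
    (h : Heisenberg (polar (localPairing F N T v))) :
    haveI := secondCountableTopology_adicCompletion F v
    ⟪SchwartzBruhat.toLp (Measure.pi fun _ : Fin N => μ')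
        (localSchrodinger F N T v ((ofSymplectic (polar (localPairing F N T v)) (MpPsi.proj _ p)).act h) φ₀),
        SchwartzBruhat.toLp (Measure.pi fun _ : Fin N => μ') f⟫_ℂ =
      ⟪SchwartzBruhat.toLp (Measure.pi fun _ : Fin N => μ') (localSchrodinger F N T v h φ₀),
        SchwartzBruhat.toLp (Measure.pi fun _ : Fin N => μ') f⟫_ℂ := by
  haveI := secondCountableTopology_adicCompletion F v
  have himp : localSchrodinger F N T v ((ofSymplectic (polar (localPairing F N T v)) (MpPsi.proj _ p)).act h) φ₀ =
      MpPsi.toRep _ p (localSchrodinger F N T v h φ₀) := by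
    conv_lhs => rw [← hp]
    exact (MpPsi.toRep_implements _ p h φ₀).symm
  rw [himp]
  conv_lhs => rw [← hf]
  exact inner_toLp_toRep_toRep μ' hTd p hφ₀ hp _ _

/-- central twist of the coefficients: `⟪[ρ((0, t) h) φ₀], [f]⟫ = conj (ψ_v t) · ⟪[ρ(h) φ₀], [f]⟫`.
[cite: MoeglinVignerasWaldspurger1987, Chap. 2 I.2] -/
theorem inner_toLp_center_mul (t : v.adicCompletion F) (h : Heisenberg (polar (localPairing F N T v)))
    (φ₀ f : SchwartzBruhat (Fin N → v.adicCompletion F)) :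
    haveI := secondCountableTopology_adicCompletion F v
    ⟪SchwartzBruhat.toLp (Measure.pi fun _ : Fin N => μ') (localSchrodinger F N T v (⟨0, t⟩ * h) φ₀),
        SchwartzBruhat.toLp (Measure.pi fun _ : Fin N => μ') f⟫_ℂ =
      (starRingEnd ℂ) ((adeleAddCharAt F v t : Circle) : ℂ) *
        ⟪SchwartzBruhat.toLp (Measure.pi fun _ : Fin N => μ') (localSchrodinger F N T v h φ₀),
          SchwartzBruhat.toLp (Measure.pi fun _ : Fin N => μ') f⟫_ℂ := by
  haveI := secondCountableTopology_adicCompletion F v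
  rw [localSchrodinger_center_mul, map_smul, inner_smul_left]

/-- right translations by the stabiliser of `φ₀` do not change the coefficients: `⟪[ρ(h (a, 0)) φ₀], [f]⟫ = ⟪[ρ(h) φ₀], [f]⟫`
if `ρ(a, 0) φ₀ = φ₀`. [folklore] -/
private theorem inner_toLp_mul_stab {a : (Fin N → v.adicCompletion F) × (Fin N → v.adicCompletion F)}
    {φ₀ : SchwartzBruhat (Fin N → v.adicCompletion F)} (ha : localSchrodinger F N T v ⟨a, 0⟩ φ₀ = φ₀)
    (h : Heisenberg (polar (localPairing F N T v))) (f : SchwartzBruhat (Fin N → v.adicCompletion F)) :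
    haveI := secondCountableTopology_adicCompletion F v
    ⟪SchwartzBruhat.toLp (Measure.pi fun _ : Fin N => μ') (localSchrodinger F N T v (h * ⟨a, 0⟩) φ₀),
        SchwartzBruhat.toLp (Measure.pi fun _ : Fin N => μ') f⟫_ℂ =
      ⟪SchwartzBruhat.toLp (Measure.pi fun _ : Fin N => μ') (localSchrodinger F N T v h φ₀),
        SchwartzBruhat.toLp (Measure.pi fun _ : Fin N => μ') f⟫_ℂ := by
  rw [map_mul, Module.End.mul_apply, ha]

/-! ## §3 Vanishing of the coefficients off `Ω` and `Λ`-quasi-periodicity -/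

/-- **the support bound, one point**: if `(g, M)` fixes `φ₀ ≠ 0` and `f`, `g w = w + a` with `ρ(a, 0) φ₀ = φ₀`, and the
phase `ψ_v(f_g(w) - B w a)` is not `1`, then `⟪[ρ(w, 0) φ₀], [f]⟫ = 0`.
[cite: MoeglinVignerasWaldspurger1987, Chap. 2 II.8] -/
theorem inner_toLp_eq_zero_of_phase (hTd : IsUnit T.det) (p : LocalMp F N T v)
    {φ₀ : SchwartzBruhat (Fin N → v.adicCompletion F)} (hφ₀ : φ₀ ≠ 0) (hp : MpPsi.toRep _ p φ₀ = φ₀)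
    {f : SchwartzBruhat (Fin N → v.adicCompletion F)} (hf : MpPsi.toRep _ p f = f)
    (w : (Fin N → v.adicCompletion F) × (Fin N → v.adicCompletion F))
    (ha : localSchrodinger F N T v ⟨(MpPsi.proj _ p).1 w - w, 0⟩ φ₀ = φ₀)
    (hψ : adeleAddCharAt F v ((ofSymplectic (polar (localPairing F N T v)) (MpPsi.proj _ p)).f w -
        polar (localPairing F N T v) w ((MpPsi.proj _ p).1 w - w)) ≠ 1) :
    haveI := secondCountableTopology_adicCompletion F v
    ⟪SchwartzBruhat.toLp (Measure.pi fun _ : Fin N => μ') (localSchrodinger F N T v ⟨w, 0⟩ φ₀),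
        SchwartzBruhat.toLp (Measure.pi fun _ : Fin N => μ') f⟫_ℂ = 0 := by
  haveI := secondCountableTopology_adicCompletion F v
  have key := inner_toLp_act μ' hTd p hφ₀ hp hf ⟨w, 0⟩
  rw [ofSymplectic_act_mk_zero] at key
  rw [inner_toLp_center_mul, inner_toLp_mul_stab μ' ha] at key
  -- `key : conj (ψ τ) * c = c`
  generalize hτ : (ofSymplectic (polar (localPairing F N T v)) (MpPsi.proj _ p)).f w -
    polar (localPairing F N T v) w ((MpPsi.proj _ p).1 w - w) = τ at key hψ
  have hne : (starRingEnd ℂ) ((adeleAddCharAt F v τ : Circle) : ℂ) ≠ 1 := by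
    intro h1
    apply hψ
    have h2 : ((adeleAddCharAt F v τ : Circle) : ℂ) = 1 := by
      rw [← Complex.conj_conj ((adeleAddCharAt F v τ : Circle) : ℂ), h1, map_one]
    exact Circle.ext h2
  have h3 : ((starRingEnd ℂ) ((adeleAddCharAt F v τ : Circle) : ℂ) - 1) *
      ⟪SchwartzBruhat.toLp (Measure.pi fun _ : Fin N => μ') (localSchrodinger F N T v ⟨w, 0⟩ φ₀),
        SchwartzBruhat.toLp (Measure.pi fun _ : Fin N => μ') f⟫_ℂ = 0 := by
    rw [sub_mul, one_mul, key, sub_self]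
  exact (mul_eq_zero.1 h3).resolve_left (sub_ne_zero.2 hne)

/-- **`Λ`-quasi-periodicity**: `⟪[ρ(w + a, 0) φ₀], [f]⟫ = conj ψ_v(-B w a) · ⟪[ρ(w, 0) φ₀], [f]⟫` when `ρ(a, 0) φ₀ = φ₀`.
[folklore] -/
private theorem inner_toLp_mk_add (w : (Fin N → v.adicCompletion F) × (Fin N → v.adicCompletion F))
    {a : (Fin N → v.adicCompletion F) × (Fin N → v.adicCompletion F)}
    {φ₀ : SchwartzBruhat (Fin N → v.adicCompletion F)} (ha : localSchrodinger F N T v ⟨a, 0⟩ φ₀ = φ₀)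
    (f : SchwartzBruhat (Fin N → v.adicCompletion F)) :
    haveI := secondCountableTopology_adicCompletion F v
    ⟪SchwartzBruhat.toLp (Measure.pi fun _ : Fin N => μ') (localSchrodinger F N T v ⟨w + a, 0⟩ φ₀),
        SchwartzBruhat.toLp (Measure.pi fun _ : Fin N => μ') f⟫_ℂ =
      (starRingEnd ℂ) ((adeleAddCharAt F v (-(polar (localPairing F N T v) w a)) : Circle) : ℂ) *
        ⟪SchwartzBruhat.toLp (Measure.pi fun _ : Fin N => μ') (localSchrodinger F N T v ⟨w, 0⟩ φ₀),
          SchwartzBruhat.toLp (Measure.pi fun _ : Fin N => μ') f⟫_ℂ := by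
  rw [heisenberg_mk_add_zero, inner_toLp_center_mul, inner_toLp_mul_stab μ' ha]

/-! ## §4 Injectivity (irreducibility on `L²`) and the finiteness theorem -/

/-- **the coefficients against the orbit of a non-zero vector separate**: if `⟪[ρ(h) φ₀], [f]⟫ = 0` for all `h ∈ H(𝕎_v)`
and `φ₀ ≠ 0`, then `f = 0` — the closed span of `{[ρ(h) φ₀]}` is a non-zero closed invariant subspace of the IRREDUCIBLE
unitary Schrödinger representation on `L²(F_vᴺ)`, hence everything, and `[f]` is orthogonal to it.
[cite: MoeglinVignerasWaldspurger1987, Chap. 2 I.2–I.3] -/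
theorem eq_zero_of_forall_inner_toLp_eq_zero (hTd : IsUnit T.det)
    {φ₀ : SchwartzBruhat (Fin N → v.adicCompletion F)} (hφ₀ : φ₀ ≠ 0)
    {f : SchwartzBruhat (Fin N → v.adicCompletion F)}
    (hf : haveI := secondCountableTopology_adicCompletion F v
      ∀ h : Heisenberg (polar (localPairing F N T v)),
        ⟪SchwartzBruhat.toLp (Measure.pi fun _ : Fin N => μ') (localSchrodinger F N T v h φ₀),
          SchwartzBruhat.toLp (Measure.pi fun _ : Fin N => μ') f⟫_ℂ = 0) :
    f = 0 := by
  haveI := secondCountableTopology_adicCompletion F v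
  set L := SchwartzBruhat.toLp (Measure.pi fun _ : Fin N => μ') with hL
  set K₀ : Submodule ℂ (Lp ℂ 2 (Measure.pi fun _ : Fin N => μ')) :=
    Submodule.span ℂ (Set.range fun h : Heisenberg (polar (localPairing F N T v)) => L (localSchrodinger F N T v h φ₀))
    with hK₀
  set K' := K₀.topologicalClosure with hK'
  -- each `ρ_{ψ_v}(h')` is continuous and maps `K₀` into itself
  have hcont : ∀ h' : Heisenberg (polar (localPairing F N T v)), Continuous (localSchrodingerL2 F N T v μ' h') :=
    fun h' => ((localSchrodingerL2 F N T v μ' h').mkContinuous 1 fun x => by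
      rw [norm_localSchrodingerL2_apply, one_mul]).continuous
  have hK₀inv : ∀ h' : Heisenberg (polar (localPairing F N T v)), ∀ x ∈ K₀, localSchrodingerL2 F N T v μ' h' x ∈ K₀ := by
    intro h' x hx
    have hle : K₀.map (localSchrodingerL2 F N T v μ' h') ≤ K₀ := by
      rw [hK₀, Submodule.map_span_le]
      rintro _ ⟨h, rfl⟩
      rw [localSchrodingerL2_apply_toLp, ← Module.End.mul_apply, ← map_mul]
      exact Submodule.subset_span ⟨h' * h, rfl⟩
    exact hle (Submodule.mem_map_of_mem hx)
  have hK'inv : ∀ h' : Heisenberg (polar (localPairing F N T v)), ∀ x ∈ K', localSchrodingerL2 F N T v μ' h' x ∈ K' := by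
    intro h' x hx
    rw [hK'] at hx ⊢
    have hx' : x ∈ closure (K₀ : Set (Lp ℂ 2 (Measure.pi fun _ : Fin N => μ'))) := by
      rwa [← Submodule.topologicalClosure_coe]
    have h1 : localSchrodingerL2 F N T v μ' h' x ∈
        closure ((localSchrodingerL2 F N T v μ' h') '' (K₀ : Set (Lp ℂ 2 (Measure.pi fun _ : Fin N => μ')))) :=
      image_closure_subset_closure_image (hcont h') ⟨x, hx', rfl⟩
    have h2 : (localSchrodingerL2 F N T v μ' h') '' (K₀ : Set (Lp ℂ 2 (Measure.pi fun _ : Fin N => μ'))) ⊆ K₀ := by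
      rintro _ ⟨y, hy, rfl⟩
      exact hK₀inv h' y hy
    have h3 := closure_mono h2 h1
    rwa [← Submodule.topologicalClosure_coe] at h3
  have hK'c : IsClosed (K' : Set (Lp ℂ 2 (Measure.pi fun _ : Fin N => μ'))) := Submodule.isClosed_topologicalClosure _
  -- `K' ≠ ⊥` since `[φ₀] ∈ K'` is non-zero
  have hφ₀K : L φ₀ ∈ K' := by
    refine K₀.le_topologicalClosure (Submodule.subset_span ⟨1, ?_⟩)
    simp only [map_one, Module.End.one_apply]
  have hLφ₀ : L φ₀ ≠ 0 := by
    rw [hL, Ne, SchwartzBruhat.toLp_eq_zero_iff]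
    exact hφ₀
  have htop : K' = ⊤ := by
    rcases localSchrodingerL2_irreducible F N T v μ' hTd K' hK'c hK'inv with hbot | htop
    · exact absurd (by simpa [hbot] using hφ₀K) hLφ₀
    · exact htop
  -- `K₀ ⟂ [f]`, hence `K' ⟂ [f]`, hence `[f] ⟂ [f]`
  have hperp : K₀ ≤ (ℂ ∙ L f)ᗮ := by
    rw [hK₀, Submodule.span_le]
    rintro _ ⟨h, rfl⟩
    rw [SetLike.mem_coe, Submodule.mem_orthogonal_singleton_iff_inner_right]
    exact inner_eq_zero_symm.1 (hf h)
  have hperp' : K' ≤ (ℂ ∙ L f)ᗮ := K₀.topologicalClosure_minimal hperp (Submodule.isClosed_orthogonal _)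
  have hff : ⟪L f, L f⟫_ℂ = 0 := by
    have : L f ∈ (ℂ ∙ L f)ᗮ := hperp' (htop ▸ Submodule.mem_top)
    exact (Submodule.mem_orthogonal_singleton_iff_inner_right.1 this)
  have hLf : L f = 0 := inner_self_eq_zero.1 hff
  rwa [hL, SchwartzBruhat.toLp_eq_zero_iff] at hLf

end MeasureA

/-- a compact set is covered by finitely many translates of an open neighbourhood of `0`. [folklore] -/
private theorem exists_finset_sub_mem_of_isCompact {W : Type*} [AddCommGroup W] [TopologicalSpace W] [IsTopologicalAddGroup W]
    {Λ Ω : Set W} (hΛo : IsOpen Λ) (hΛ0 : (0 : W) ∈ Λ) (hΩ : IsCompact Ω) :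
    ∃ R : Finset W, ∀ w ∈ Ω, ∃ r ∈ R, w - r ∈ Λ := by
  obtain ⟨R, hR⟩ := hΩ.elim_finite_subcover (fun r : W => (fun x => x - r) ⁻¹' Λ)
    (fun r => hΛo.preimage (continuous_id.sub continuous_const))
    (fun w _ => Set.mem_iUnion.2 ⟨w, by simpa using hΛ0⟩)
  refine ⟨R, fun w hw => ?_⟩
  simpa only [Set.mem_iUnion, Set.mem_preimage, exists_prop] using hR hw

section MeasureB

variable [MeasurableSpace (v.adicCompletion F)] [BorelSpace (v.adicCompletion F)]
  (μ' : Measure (v.adicCompletion F)) [μ'.IsAddHaarMeasure]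

/-- **all coefficients vanish** (hence `f = 0`) once they vanish at finitely many representatives `r ∈ R` of the
`Λ`-translates covering `Ω`, under the expansion hypothesis off `Ω`. [cite: MoeglinVignerasWaldspurger1987, Chap. 2 II.8] -/
theorem eq_zero_of_inner_toLp_eq_zero_on_finset (hTd : IsUnit T.det) {G : Type*} [Group G] (σ : G →* LocalMp F N T v)
    (K : Subgroup G) {φ₀ : SchwartzBruhat (Fin N → v.adicCompletion F)} (hφ₀ : φ₀ ≠ 0)
    (hKφ₀ : ∀ k ∈ K, MpPsi.toRep _ (σ k) φ₀ = φ₀)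
    {Λ : Set ((Fin N → v.adicCompletion F) × (Fin N → v.adicCompletion F))}
    (hΛ : ∀ a ∈ Λ, localSchrodinger F N T v ⟨a, 0⟩ φ₀ = φ₀)
    {Ω : Set ((Fin N → v.adicCompletion F) × (Fin N → v.adicCompletion F))}
    (hexp : ∀ w, w ∉ Ω → ∃ k ∈ K, (MpPsi.proj _ (σ k)).1 w - w ∈ Λ ∧
      adeleAddCharAt F v ((ofSymplectic (polar (localPairing F N T v)) (MpPsi.proj _ (σ k))).f w -
        polar (localPairing F N T v) w ((MpPsi.proj _ (σ k)).1 w - w)) ≠ 1)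
    {R : Finset ((Fin N → v.adicCompletion F) × (Fin N → v.adicCompletion F))} (hR : ∀ w ∈ Ω, ∃ r ∈ R, w - r ∈ Λ)
    {f : SchwartzBruhat (Fin N → v.adicCompletion F)} (hf : ∀ k ∈ K, MpPsi.toRep _ (σ k) f = f)
    (hfR : haveI := secondCountableTopology_adicCompletion F v
      ∀ r ∈ R, ⟪SchwartzBruhat.toLp (Measure.pi fun _ : Fin N => μ') (localSchrodinger F N T v ⟨r, 0⟩ φ₀),
        SchwartzBruhat.toLp (Measure.pi fun _ : Fin N => μ') f⟫_ℂ = 0) :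
    f = 0 := by
  haveI := secondCountableTopology_adicCompletion F v
  have hW : ∀ w : (Fin N → v.adicCompletion F) × (Fin N → v.adicCompletion F),
      ⟪SchwartzBruhat.toLp (Measure.pi fun _ : Fin N => μ') (localSchrodinger F N T v ⟨w, 0⟩ φ₀),
        SchwartzBruhat.toLp (Measure.pi fun _ : Fin N => μ') f⟫_ℂ = 0 := by
    intro w
    by_cases hw : w ∈ Ω
    · obtain ⟨r, hr, hwr⟩ := hR w hw
      have e : w = r + (w - r) := by abel
      rw [e, inner_toLp_mk_add μ' r (hΛ _ hwr), hfR r hr, mul_zero]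
    · obtain ⟨k, hk, hkΛ, hkψ⟩ := hexp w hw
      exact inner_toLp_eq_zero_of_phase μ' hTd (σ k) hφ₀ (hKφ₀ k hk) (hf k hk) w (hΛ _ hkΛ) hkψ
  refine eq_zero_of_forall_inner_toLp_eq_zero μ' hTd hφ₀ fun h => ?_
  have e : h = ⟨0, h.t⟩ * ⟨h.v, 0⟩ := Heisenberg.ext (by simp) (by simp)
  rw [e, inner_toLp_center_mul, hW, mul_zero]

include μ' in
/-- the finiteness theorem with the Haar measure as a parameter (see `finite_fixedPoints_of_expansion`).
[cite: MoeglinVignerasWaldspurger1987, Chap. 2 II.8] -/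
theorem finite_fixedPoints_of_expansion_aux (hTd : IsUnit T.det) {G : Type*} [Group G] (σ : G →* LocalMp F N T v)
    (K : Subgroup G) {φ₀ : SchwartzBruhat (Fin N → v.adicCompletion F)} (hφ₀ : φ₀ ≠ 0)
    (hKφ₀ : ∀ k ∈ K, MpPsi.toRep _ (σ k) φ₀ = φ₀)
    {Λ : Set ((Fin N → v.adicCompletion F) × (Fin N → v.adicCompletion F))} (hΛo : IsOpen Λ) (hΛ0 : (0 : _) ∈ Λ)
    (hΛ : ∀ a ∈ Λ, localSchrodinger F N T v ⟨a, 0⟩ φ₀ = φ₀)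
    {Ω : Set ((Fin N → v.adicCompletion F) × (Fin N → v.adicCompletion F))} (hΩ : IsCompact Ω)
    (hexp : ∀ w, w ∉ Ω → ∃ k ∈ K, (MpPsi.proj _ (σ k)).1 w - w ∈ Λ ∧
      adeleAddCharAt F v ((ofSymplectic (polar (localPairing F N T v)) (MpPsi.proj _ (σ k))).f w -
        polar (localPairing F N T v) w ((MpPsi.proj _ (σ k)).1 w - w)) ≠ 1) :
    Module.Finite ℂ (Representation.fixedPoints ((MpPsi.toRep (localSchrodinger F N T v)).comp σ) K) := by
  classical
  haveI := secondCountableTopology_adicCompletion F v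
  obtain ⟨R, hR⟩ := exists_finset_sub_mem_of_isCompact hΛo hΛ0 hΩ
  -- the coefficient map `f ↦ (⟪[ρ(r, 0) φ₀], [f]⟫)_{r ∈ R}` on all of `𝒮(F_vᴺ)` (kept opaque: only its formula is used)
  obtain ⟨Ψ, hΨ⟩ : ∃ Ψ : SchwartzBruhat (Fin N → v.adicCompletion F) →ₗ[ℂ] ({r // r ∈ R} → ℂ), ∀ f r, Ψ f r =
        ⟪SchwartzBruhat.toLp (Measure.pi fun _ : Fin N => μ')
            (localSchrodinger F N T v ⟨(r.1 : (Fin N → v.adicCompletion F) × (Fin N → v.adicCompletion F)), 0⟩ φ₀),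
          SchwartzBruhat.toLp (Measure.pi fun _ : Fin N => μ') f⟫_ℂ :=
    ⟨LinearMap.pi fun r : {r // r ∈ R} => ((innerSL ℂ (SchwartzBruhat.toLp (Measure.pi fun _ : Fin N => μ')
      (localSchrodinger F N T v ⟨(r.1 : (Fin N → v.adicCompletion F) × (Fin N → v.adicCompletion F)), 0⟩ φ₀))).toLinearMap ∘ₗ
        (SchwartzBruhat.toLp (Measure.pi fun _ : Fin N => μ'))),
      fun f r => by
        simp only [LinearMap.pi_apply, LinearMap.coe_comp, Function.comp_apply, ContinuousLinearMap.coe_coe,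
          innerSL_apply_apply]⟩
  -- `Ψ` is injective on the fixed vectors
  have key : ∀ a b : SchwartzBruhat (Fin N → v.adicCompletion F),
      (∀ k ∈ K, MpPsi.toRep (localSchrodinger F N T v) (σ k) a = a) →
      (∀ k ∈ K, MpPsi.toRep (localSchrodinger F N T v) (σ k) b = b) → Ψ a = Ψ b → a = b := by
    intro a b ha hb hab
    refine sub_eq_zero.1 ?_
    have hfix : ∀ k ∈ K, MpPsi.toRep (localSchrodinger F N T v) (σ k) (a - b) = a - b := fun k hk =>
      calc MpPsi.toRep (localSchrodinger F N T v) (σ k) (a - b)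
          = MpPsi.toRep (localSchrodinger F N T v) (σ k) a - MpPsi.toRep (localSchrodinger F N T v) (σ k) b :=
            (MpPsi.toRep (localSchrodinger F N T v) (σ k)).map_sub a b
        _ = a - b := by rw [ha k hk, hb k hk]
    have hfR : ∀ r ∈ R, ⟪SchwartzBruhat.toLp (Measure.pi fun _ : Fin N => μ') (localSchrodinger F N T v ⟨r, 0⟩ φ₀),
        SchwartzBruhat.toLp (Measure.pi fun _ : Fin N => μ') (a - b)⟫_ℂ = 0 := fun r hr => by
      rw [map_sub, inner_sub_right, ← hΨ a ⟨r, hr⟩, ← hΨ b ⟨r, hr⟩, hab, sub_self]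
    exact eq_zero_of_inner_toLp_eq_zero_on_finset μ' hTd σ K hφ₀ hKφ₀ hΛ hexp hR hfix hfR
  refine Module.Finite.of_injective
    (Ψ.domRestrict (Representation.fixedPoints ((MpPsi.toRep (localSchrodinger F N T v)).comp σ) K)) ?_
  rintro ⟨a, ha⟩ ⟨b, hb⟩ hab
  rw [Representation.mem_fixedPoints] at ha hb
  exact Subtype.ext (key a b (fun k hk => ha k hk) (fun k hk => hb k hk) hab)

end MeasureB

/-- **FINITENESS OF FIXED VECTORS FROM EXPANSION.**  Let `σ : G → S̃p_{ψ_v}(𝕎_v)` and `K ≤ G`.  Suppose (a) `K` fixes a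
non-zero `φ₀ ∈ 𝒮(F_vᴺ)`; (b) `Λ ⊆ 𝕎_v` is open, contains `0`, and `ρ(a, 0) φ₀ = φ₀` for `a ∈ Λ`; (c) `Ω ⊆ 𝕎_v` is compact
and every `w ∉ Ω` is EXPANDED by some `k ∈ K`: `g w - w ∈ Λ` and `ψ_v(½ (B (gw)(gw) - B w w) - B w (g w - w)) ≠ 1` for
`g = p(σ k)`.  Then the `K`-fixed vectors of `𝒮(F_vᴺ)` under `σ` form a finite-dimensional space (they embed, by
`f ↦ (⟪[ρ(r, 0) φ₀], [f]⟫)_r`, into the functions on a finite set of representatives of the `Λ`-translates covering `Ω`).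
This is the lattice-model support bound behind the admissibility of theta lifts from compact members of dual pairs.
[cite: MoeglinVignerasWaldspurger1987, Chap. 2 II.8] [cite: Howe1979, §2] -/
theorem finite_fixedPoints_of_expansion (hTd : IsUnit T.det) {G : Type*} [Group G] (σ : G →* LocalMp F N T v)
    (K : Subgroup G) {φ₀ : SchwartzBruhat (Fin N → v.adicCompletion F)} (hφ₀ : φ₀ ≠ 0)
    (hKφ₀ : ∀ k ∈ K, MpPsi.toRep _ (σ k) φ₀ = φ₀)
    {Λ : Set ((Fin N → v.adicCompletion F) × (Fin N → v.adicCompletion F))} (hΛo : IsOpen Λ) (hΛ0 : (0 : _) ∈ Λ)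
    (hΛ : ∀ a ∈ Λ, localSchrodinger F N T v ⟨a, 0⟩ φ₀ = φ₀)
    {Ω : Set ((Fin N → v.adicCompletion F) × (Fin N → v.adicCompletion F))} (hΩ : IsCompact Ω)
    (hexp : ∀ w, w ∉ Ω → ∃ k ∈ K, (MpPsi.proj _ (σ k)).1 w - w ∈ Λ ∧
      adeleAddCharAt F v ((ofSymplectic (polar (localPairing F N T v)) (MpPsi.proj _ (σ k))).f w -
        polar (localPairing F N T v) w ((MpPsi.proj _ (σ k)).1 w - w)) ≠ 1) :
    Module.Finite ℂ (Representation.fixedPoints ((MpPsi.toRep (localSchrodinger F N T v)).comp σ) K) := by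
  letI : MeasurableSpace (v.adicCompletion F) := borel _
  haveI : BorelSpace (v.adicCompletion F) := ⟨rfl⟩
  exact finite_fixedPoints_of_expansion_aux Measure.addHaar hTd σ K hφ₀ hKφ₀ hΛo hΛ0 hΛ hΩ hexp

end Literature.NumberTheory.GelbartRogawski1991.UnitaryDualPair.LocalSplitting

end
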